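import Summits.SmoothPoincare4.SmoothPoincare4.Theorems.ContractibleTwistedDoubleStandard.Negative.DoubleBisection
import Literature.AlgebraicTopology.SingularHomology.ExcisionMayerVietoris

/-!
# `ContractibleTwistedDoubleStandard` — negative-side support: `S⁴` lies in every sub-sector

The round sphere's hemisphere bisection (`Negative.DoubleBisection.crux_hypotheses_at_sphere`:
`S⁴ = 𝔻⁴ ∪_id 𝔻⁴`, standard Stein ball on both halves, equal complex tangencies on the seam) has
CONTRACTIBLE, hence ℚ-ACYCLIC halves. Recorded here in the exact shape of the route's ∃-hypotheses:

* `acyclicBisection_sphere` — the round `S⁴` admits a Stein bisection along a common contact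
  seam with ℚ-acyclic halves: the `M = S⁴` instance of the body of
  `ConvexBisection.AcyclicBisectionExists` (stmt-SmoothPoincare4-10508) and NON-VACUITY of the
  hypothesis of `ConvexBisection.AcyclicBisectionRigidity` (stmt-SmoothPoincare4-10507) — the
  formal gap recorded in `Cruxes/AcyclicBisectionRigidity/Disproof.lean` §8 — as well as of
  `SteinBisectionExists` (stmt-10509) at `S⁴`;
* `acyclicBisectionExists_of_diffeomorph`-free remark: for every `M ≃ₘ S⁴` the same holds by
  transport (not needed by the route's deciding theorem, omitted).
So no refutation of any ConvexBisection crux can come from the round sphere, and the contractible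
sector (this crux) sits inside the acyclic one (rank-2 crux) non-vacuously.
-/

noncomputable section

open scoped Manifold ContDiff Topology
open Set Function ContinuousMap Literature.Geometry.Symplectic Literature.Topology.FourManifolds
  Literature.AlgebraicTopology.SingularHomology

namespace Summit.SmoothPoincare4.SmoothPoincare4.Theorems.ContractibleTwistedDoubleStandard.Negative

open Summit.SmoothPoincare4.SmoothPoincare4.Theses.ConvexBisection

/-- **The round `S⁴` admits a Stein bisection along a common contact seam with ℚ-acyclic
(indeed contractible) halves** — the body of `ConvexBisection.AcyclicBisectionExists` at
`M = S⁴`, witnessed by the hemisphere bisection `S⁴ = 𝔻⁴ ∪_id 𝔻⁴` with the standard Stein ball on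
both halves (`crux_hypotheses_at_sphere`) and `H_k(𝔻⁴; ℚ) = 0` for `k > 0`
(`isZero_singularHomology_of_contractibleSpace`, `contractibleSpace_closedBall_four`). [folklore] -/
theorem acyclicBisection_sphere :
    ∃ (W₁ : Type) (_ : TopologicalSpace W₁) (_ : ChartedSpace (EuclideanHalfSpace 4) W₁)
      (_ : IsManifold (𝓡∂ 4) ∞ W₁) (_ : CompactSpace W₁) (W₂ : Type) (_ : TopologicalSpace W₂)
      (_ : ChartedSpace (EuclideanHalfSpace 4) W₂) (_ : IsManifold (𝓡∂ 4) ∞ W₂) (_ : CompactSpace W₂)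
      (J₁ : SteinStructure W₁) (J₂ : SteinStructure W₂)
      (e₁ : W₁ → Metric.sphere (0 : EuclideanSpace ℝ (Fin 5)) 1)
      (e₂ : W₂ → Metric.sphere (0 : EuclideanSpace ℝ (Fin 5)) 1),
      Manifold.IsSmoothEmbedding (𝓡∂ 4) (𝓡 4) ∞ e₁ ∧ Manifold.IsSmoothEmbedding (𝓡∂ 4) (𝓡 4) ∞ e₂ ∧
      Set.range e₁ ∪ Set.range e₂ = Set.univ ∧
      Set.range e₁ ∩ Set.range e₂ = e₁ '' (𝓡∂ 4).boundary W₁ ∧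
      Set.range e₁ ∩ Set.range e₂ = e₂ '' (𝓡∂ 4).boundary W₂ ∧
      (∀ w₁ w₂, e₁ w₁ = e₂ w₂ →
        Submodule.map (mfderiv (𝓡∂ 4) (𝓡 4) e₁ w₁).toLinearMap (contactPlane J₁.J w₁) =
          Submodule.map (mfderiv (𝓡∂ 4) (𝓡 4) e₂ w₂).toLinearMap (contactPlane J₂.J w₂)) ∧
      (∀ k, 0 < k →
        CategoryTheory.Limits.IsZero (singularHomology ℚ ℚ W₁ k) ∧
          CategoryTheory.Limits.IsZero (singularHomology ℚ ℚ W₂ k)) := by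
  obtain ⟨e₁, e₂, h1, h2, h3, h4, h5, h6⟩ := crux_hypotheses_at_sphere
  haveI := contractibleSpace_closedBall_four
  refine ⟨_, inferInstance, inferInstance, inferInstance, inferInstance, _, inferInstance,
    inferInstance, inferInstance, inferInstance, steinStructureClosedBall, steinStructureClosedBall,
    e₁, e₂, h1, h2, h3, h4, h5, h6, fun k hk => ⟨?_, ?_⟩⟩ <;>
    exact isZero_singularHomology_of_contractibleSpace ℚ ℚ (Nat.pos_iff_ne_zero.1 hk)

/-- Hence **`AcyclicBisectionExists` holds at the round sphere** (its body at `M = S⁴`, for the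
identity homotopy equivalence or any other): the rank-3 crux cannot fail at `S⁴`, and the
hypothesis of the rank-2 crux `AcyclicBisectionRigidity` is inhabited at `S⁴`. [folklore] -/
theorem acyclicBisectionExists_sphere
    (_e : Metric.sphere (0 : EuclideanSpace ℝ (Fin 5)) 1 ≃ₕ Metric.sphere (0 : EuclideanSpace ℝ (Fin 5)) 1) :
    ∃ (W₁ : Type) (_ : TopologicalSpace W₁) (_ : ChartedSpace (EuclideanHalfSpace 4) W₁)
      (_ : IsManifold (𝓡∂ 4) ∞ W₁) (_ : CompactSpace W₁) (W₂ : Type) (_ : TopologicalSpace W₂)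
      (_ : ChartedSpace (EuclideanHalfSpace 4) W₂) (_ : IsManifold (𝓡∂ 4) ∞ W₂) (_ : CompactSpace W₂)
      (J₁ : SteinStructure W₁) (J₂ : SteinStructure W₂)
      (e₁ : W₁ → Metric.sphere (0 : EuclideanSpace ℝ (Fin 5)) 1)
      (e₂ : W₂ → Metric.sphere (0 : EuclideanSpace ℝ (Fin 5)) 1),
      Manifold.IsSmoothEmbedding (𝓡∂ 4) (𝓡 4) ∞ e₁ ∧ Manifold.IsSmoothEmbedding (𝓡∂ 4) (𝓡 4) ∞ e₂ ∧
      Set.range e₁ ∪ Set.range e₂ = Set.univ ∧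
      Set.range e₁ ∩ Set.range e₂ = e₁ '' (𝓡∂ 4).boundary W₁ ∧
      Set.range e₁ ∩ Set.range e₂ = e₂ '' (𝓡∂ 4).boundary W₂ ∧
      (∀ w₁ w₂, e₁ w₁ = e₂ w₂ →
        Submodule.map (mfderiv (𝓡∂ 4) (𝓡 4) e₁ w₁).toLinearMap (contactPlane J₁.J w₁) =
          Submodule.map (mfderiv (𝓡∂ 4) (𝓡 4) e₂ w₂).toLinearMap (contactPlane J₂.J w₂)) ∧
      (∀ k, 0 < k →
        CategoryTheory.Limits.IsZero (singularHomology ℚ ℚ W₁ k) ∧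
          CategoryTheory.Limits.IsZero (singularHomology ℚ ℚ W₂ k)) :=
  acyclicBisection_sphere

end Summit.SmoothPoincare4.SmoothPoincare4.Theorems.ContractibleTwistedDoubleStandard.Negative
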